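import Summits.ValiantsHypothesis.ValiantsHypothesis.Theorems.LacunarySymmetroidMatrixDescartesCensusDoorA34SheetTwistedBlocks
import Summits.ValiantsHypothesis.ValiantsHypothesis.Theorems.LacunarySymmetroidMatrixDescartesCensusDoorA34NullNullSheetDefiniteLetter

/-!
# `MatrixDescartes` census — DOOR A at `(3,4)`: the two END-WINDOW TRINOMIAL INEQUALITIES of a hypothetical null-null seventeen (twisted bottom window
# `{0,0,e}` and twisted top window `{e,3,3}` are Descartes-sharp trinomials ⇒ explicit magnitude inequalities on `tr(adj S₀·S_e)` and `tr(adj S₃·S_e)`)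

HONEST FRAMING.  Object-search cell `pub-symmetroid`, engine seat `val-sym-eng-2` (g8); helper rows beside the registered strata line
`Cruxes/DoorA34/Lines/strata.lean` on stmt-ValiantsHypothesis-19980 (`DoorA34 = PosRootLawAt 3 4 18`: OPEN, typed, never asserted here); third stub
`stub_nullNullCeiling` (`det S₀ = det S₃ = 0 ⇒ ≤ 16`).  Companion of …DoorA34SheetTwistedBlocks (`twistedSubword_sharp_of_nullNull_seventeen`: on a null-null
seventeen EVERY twisted sub-word of the 18-letter word is Descartes-sharp).  Here the two three-slot END WINDOWS are made explicit, exactly as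
`topTrinomial_ineq_of_nullTop_eighteen` did for the null-top sheet:
* **`bottomTrinomial_ineq_of_nullNull_seventeen`** — bottom window `{0,0,1}, {0,0,2}, {0,0,3}` (exponents `2d₀ + d_e`, coefficients `β_e = tr(adj S₀·S_e)`, gaps
  `a = d₂ − d₁`, `b = d₃ − d₂`): `(a+b)^{a+b} |W(2d₀+d₁)β₁|^b |W(2d₀+d₃)β₃|^a ≤ |W(2d₀+d₂)β₂|^{a+b} aᵃ bᵇ`;
* **`topTrinomial_ineq_of_nullNull_seventeen`** — top window `{0,3,3}, {1,3,3}, {2,3,3}` (exponents `2d₃ + d_e`, `τ_e = tr(adj S₃·S_e)`, gaps `a = d₁ − d₀`,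
  `b = d₂ − d₁`): `(a+b)^{a+b} |W(2d₃+d₀)τ₀|^b |W(2d₃+d₂)τ₂|^a ≤ |W(2d₃+d₁)τ₁|^{a+b} aᵃ bᵇ`;
with the twist weights `W(n) = ∏ (n − σ(u))` over the `15` other slots (explicit integers depending on `d` only).  LOCATED (HOME/DOOR-A34-ENG2G8-REPORT.md §4a): on the
null-null sixteen of record (p583093) and the bulk null-null fifteen (p558265) both twisted end windows ARE sharp; their deficiencies sit in the cross block `{0,x,3}` /
the middle blocks / the two-letter core block — the end-window inequalities are necessary, not sufficient.  Nothing here bounds anything else; `DoorA34` and the three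
stubs stay OPEN; registers unchanged; nothing on `MatrixDescartes` (stmt-ValiantsHypothesis-18050) or `VP ≠ VNP` — VP≠VNP not moved.  [folklore] Rolle / weighted AM–GM.
-/

-- `Summit.ValiantsHypothesis.ValiantsHypothesis.…` repeats a component by the D-0017 layout
-- (single-conjunct summit), which the `dupNamespace` linter flags; the name is mandated.
set_option linter.dupNamespace false

namespace Summit.ValiantsHypothesis.ValiantsHypothesis.Theorems.LacunarySymmetroidMatrixDescartes.Census

open Polynomial Finset
open scoped BigOperators Polynomial Matrix

/-- The bottom window of the null-null sheet: the three slots `{0,0,e}`, `e = 1,2,3`, inside the `18` null-null slots. [folklore] -/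
theorem bottomWindowSlots_subset :
    ({⟨{0, 0, 1}, by simp⟩, ⟨{0, 0, 2}, by simp⟩, ⟨{0, 0, 3}, by simp⟩} : Finset (Sym (Fin 4) 3))
      ⊆ ((Finset.univ : Finset (Sym (Fin 4) 3)).erase (Sym.replicate 3 3)).erase (Sym.replicate 3 0) := by decide

/-- The top window of the null-null sheet: the three slots `{e,3,3}`, `e = 0,1,2`. [folklore] -/
theorem topWindowSlots_subset :
    ({⟨{3, 3, 0}, by simp⟩, ⟨{3, 3, 1}, by simp⟩, ⟨{3, 3, 2}, by simp⟩} : Finset (Sym (Fin 4) 3))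
      ⊆ ((Finset.univ : Finset (Sym (Fin 4) 3)).erase (Sym.replicate 3 3)).erase (Sym.replicate 3 0) := by decide

/-- **BOTTOM-WINDOW TRINOMIAL INEQUALITY OF A NULL-NULL SEVENTEEN.**  Sorted support with gaps `d₂ = d₁ + a`, `d₃ = d₂ + b`, `det S₀ = det S₃ = 0`, `17` distinct
positive roots; `β_e = tr(adj S₀·S_e)`; `W` the twist weights of the bottom window.  Then the twisted bottom window has two positive roots, so
`(a+b)^{a+b} |W(2d₀+d₁)β₁|^b |W(2d₀+d₃)β₃|^a ≤ |W(2d₀+d₂)β₂|^{a+b} aᵃ bᵇ`. [folklore] -/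
theorem bottomTrinomial_ineq_of_nullNull_seventeen (d : Fin 4 → ℕ) (hd : StrictMono d) (S : Fin 4 → Matrix (Fin 3) (Fin 3) ℝ)
    (h0 : (S 0).det = 0) (h3 : (S 3).det = 0)
    (h17 : 17 ≤ ((Matrix.det (∑ l, ((X : ℝ[X]) ^ d l) • (S l).map C)).roots.toFinset.filter (fun t => 0 < t)).card)
    {a b : ℕ} (ha : d 2 = d 1 + a) (hb : d 3 = d 2 + b)
    (W : ℕ → ℝ) (hW : ∀ n, W n =
      ∏ E ∈ (((((Finset.univ : Finset (Sym (Fin 4) 3)).erase (Sym.replicate 3 3)).erase (Sym.replicate 3 0)) \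
          ({⟨{0, 0, 1}, by simp⟩, ⟨{0, 0, 2}, by simp⟩, ⟨{0, 0, 3}, by simp⟩} : Finset (Sym (Fin 4) 3))).image
          (fun s : Sym (Fin 4) 3 => ((s : Multiset (Fin 4)).map d).sum)).image (fun m : ℕ => (m : ℝ)), ((n : ℝ) - E)) :
    ((a : ℝ) + b) ^ (a + b) * |W (2 * d 0 + d 1) * ((S 0).adjugate * S 1).trace| ^ b * |W (2 * d 0 + d 3) * ((S 0).adjugate * S 3).trace| ^ a
      ≤ |W (2 * d 0 + d 2) * ((S 0).adjugate * S 2).trace| ^ (a + b) * (a : ℝ) ^ a * (b : ℝ) ^ b := by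
  have ha0 : 0 < a := by have := hd (show (1 : Fin 4) < 2 by decide); omega
  have hb0 : 0 < b := by have := hd (show (2 : Fin 4) < 3 by decide); omega
  have h01 : d 0 < d 1 := hd (show (0 : Fin 4) < 1 by decide)
  obtain ⟨g, hg, hsupp, hZ⟩ := twistedSubword_sharp_of_nullNull_seventeen d S h0 h3 h17 _ bottomWindowSlots_subset ⟨_, Finset.mem_insert_self _ _⟩
  have hcardB : ({⟨{0, 0, 1}, by simp⟩, ⟨{0, 0, 2}, by simp⟩, ⟨{0, 0, 3}, by simp⟩} : Finset (Sym (Fin 4) 3)).card = 3 := by decide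
  rw [hcardB] at hZ
  have hmemB : ∀ n ∈ g.support, n = 2 * d 0 + d 1 ∨ n = 2 * d 0 + d 2 ∨ n = 2 * d 0 + d 3 := by
    intro n hn
    have h := hsupp hn
    simp only [Finset.image_insert, Finset.image_singleton, Finset.mem_insert, Finset.mem_singleton, Sym.coe_mk,
      Multiset.insert_eq_cons, Multiset.map_cons, Multiset.sum_cons, Multiset.map_singleton, Multiset.sum_singleton] at h
    omega
  have hcoef : ∀ e : Fin 4, e ≠ 0 → g.coeff (2 * d 0 + d e) = W (2 * d 0 + d e) * ((S 0).adjugate * S e).trace := by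
    intro e he
    rw [hg, hW, (coeff_square_of_nullNull_seventeen d hd S h0 h3 h17 0 e (Ne.symm he)).1]
  have hdist12 : 2 * d 0 + d 1 ≠ 2 * d 0 + d 2 := by omega
  have hdist13 : 2 * d 0 + d 1 ≠ 2 * d 0 + d 3 := by omega
  have hdist23 : 2 * d 0 + d 2 ≠ 2 * d 0 + d 3 := by omega
  have hgeq : g = C (W (2 * d 0 + d 1) * ((S 0).adjugate * S 1).trace) * X ^ (2 * d 0 + d 1)
      + C (W (2 * d 0 + d 2) * ((S 0).adjugate * S 2).trace) * X ^ (2 * d 0 + d 1 + a)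
      + C (W (2 * d 0 + d 3) * ((S 0).adjugate * S 3).trace) * X ^ (2 * d 0 + d 1 + a + b) := by
    have e1 : 2 * d 0 + d 1 + a = 2 * d 0 + d 2 := by omega
    have e2 : 2 * d 0 + d 2 + b = 2 * d 0 + d 3 := by omega
    rw [e1, e2]
    ext n
    simp only [coeff_add, coeff_C_mul, coeff_X_pow]
    by_cases h1 : n = 2 * d 0 + d 1
    · subst h1; rw [hcoef 1 (by decide), if_pos rfl, if_neg hdist12, if_neg hdist13]; ring
    by_cases h2 : n = 2 * d 0 + d 2
    · subst h2; rw [hcoef 2 (by decide), if_neg (Ne.symm hdist12), if_pos rfl, if_neg hdist23]; ring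
    by_cases h3' : n = 2 * d 0 + d 3
    · subst h3'; rw [hcoef 3 (by decide), if_neg (Ne.symm hdist13), if_neg (Ne.symm hdist23), if_pos rfl]; ring
    have hn : n ∉ g.support := fun hn => by rcases hmemB n hn with h | h | h <;> contradiction
    rw [notMem_support_iff.mp hn, if_neg h1, if_neg h2, if_neg h3']; ring
  have h2 : 1 < ((C (W (2 * d 0 + d 1) * ((S 0).adjugate * S 1).trace) * X ^ (2 * d 0 + d 1)
      + C (W (2 * d 0 + d 2) * ((S 0).adjugate * S 2).trace) * X ^ (2 * d 0 + d 1 + a)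
      + C (W (2 * d 0 + d 3) * ((S 0).adjugate * S 3).trace) * X ^ (2 * d 0 + d 1 + a + b)).roots.toFinset.filter
        (fun x => 0 < x)).card := by
    rw [← hgeq]; omega
  exact trinomial_two_posRoots_le ha0 hb0 _ _ _ h2

/-- **TOP-WINDOW TRINOMIAL INEQUALITY OF A NULL-NULL SEVENTEEN.**  Sorted support with gaps `d₁ = d₀ + a`, `d₂ = d₁ + b`, `det S₀ = det S₃ = 0`, `17` distinct positive
roots; `τ_e = tr(adj S₃·S_e)`; `W` the twist weights of the top window.  Then `(a+b)^{a+b} |W(2d₃+d₀)τ₀|^b |W(2d₃+d₂)τ₂|^a ≤ |W(2d₃+d₁)τ₁|^{a+b} aᵃ bᵇ`. [folklore] -/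
theorem topTrinomial_ineq_of_nullNull_seventeen (d : Fin 4 → ℕ) (hd : StrictMono d) (S : Fin 4 → Matrix (Fin 3) (Fin 3) ℝ)
    (h0 : (S 0).det = 0) (h3 : (S 3).det = 0)
    (h17 : 17 ≤ ((Matrix.det (∑ l, ((X : ℝ[X]) ^ d l) • (S l).map C)).roots.toFinset.filter (fun t => 0 < t)).card)
    {a b : ℕ} (ha : d 1 = d 0 + a) (hb : d 2 = d 1 + b)
    (W : ℕ → ℝ) (hW : ∀ n, W n =
      ∏ E ∈ (((((Finset.univ : Finset (Sym (Fin 4) 3)).erase (Sym.replicate 3 3)).erase (Sym.replicate 3 0)) \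
          ({⟨{3, 3, 0}, by simp⟩, ⟨{3, 3, 1}, by simp⟩, ⟨{3, 3, 2}, by simp⟩} : Finset (Sym (Fin 4) 3))).image
          (fun s : Sym (Fin 4) 3 => ((s : Multiset (Fin 4)).map d).sum)).image (fun m : ℕ => (m : ℝ)), ((n : ℝ) - E)) :
    ((a : ℝ) + b) ^ (a + b) * |W (2 * d 3 + d 0) * ((S 3).adjugate * S 0).trace| ^ b * |W (2 * d 3 + d 2) * ((S 3).adjugate * S 2).trace| ^ a
      ≤ |W (2 * d 3 + d 1) * ((S 3).adjugate * S 1).trace| ^ (a + b) * (a : ℝ) ^ a * (b : ℝ) ^ b := by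
  have ha0 : 0 < a := by have := hd (show (0 : Fin 4) < 1 by decide); omega
  have hb0 : 0 < b := by have := hd (show (1 : Fin 4) < 2 by decide); omega
  have h23 : d 2 < d 3 := hd (show (2 : Fin 4) < 3 by decide)
  obtain ⟨g, hg, hsupp, hZ⟩ := twistedSubword_sharp_of_nullNull_seventeen d S h0 h3 h17 _ topWindowSlots_subset ⟨_, Finset.mem_insert_self _ _⟩
  have hcardB : ({⟨{3, 3, 0}, by simp⟩, ⟨{3, 3, 1}, by simp⟩, ⟨{3, 3, 2}, by simp⟩} : Finset (Sym (Fin 4) 3)).card = 3 := by decide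
  rw [hcardB] at hZ
  have hmemB : ∀ n ∈ g.support, n = 2 * d 3 + d 0 ∨ n = 2 * d 3 + d 1 ∨ n = 2 * d 3 + d 2 := by
    intro n hn
    have h := hsupp hn
    simp only [Finset.image_insert, Finset.image_singleton, Finset.mem_insert, Finset.mem_singleton, Sym.coe_mk,
      Multiset.insert_eq_cons, Multiset.map_cons, Multiset.sum_cons, Multiset.map_singleton, Multiset.sum_singleton] at h
    omega
  have hcoef : ∀ e : Fin 4, e ≠ 3 → g.coeff (2 * d 3 + d e) = W (2 * d 3 + d e) * ((S 3).adjugate * S e).trace := by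
    intro e he
    rw [hg, hW, (coeff_square_of_nullNull_seventeen d hd S h0 h3 h17 3 e (Ne.symm he)).1]
  have hdist01 : 2 * d 3 + d 0 ≠ 2 * d 3 + d 1 := by omega
  have hdist02 : 2 * d 3 + d 0 ≠ 2 * d 3 + d 2 := by omega
  have hdist12 : 2 * d 3 + d 1 ≠ 2 * d 3 + d 2 := by omega
  have hgeq : g = C (W (2 * d 3 + d 0) * ((S 3).adjugate * S 0).trace) * X ^ (2 * d 3 + d 0)
      + C (W (2 * d 3 + d 1) * ((S 3).adjugate * S 1).trace) * X ^ (2 * d 3 + d 0 + a)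
      + C (W (2 * d 3 + d 2) * ((S 3).adjugate * S 2).trace) * X ^ (2 * d 3 + d 0 + a + b) := by
    have e1 : 2 * d 3 + d 0 + a = 2 * d 3 + d 1 := by omega
    have e2 : 2 * d 3 + d 1 + b = 2 * d 3 + d 2 := by omega
    rw [e1, e2]
    ext n
    simp only [coeff_add, coeff_C_mul, coeff_X_pow]
    by_cases h0' : n = 2 * d 3 + d 0
    · subst h0'; rw [hcoef 0 (by decide), if_pos rfl, if_neg hdist01, if_neg hdist02]; ring
    by_cases h1 : n = 2 * d 3 + d 1
    · subst h1; rw [hcoef 1 (by decide), if_neg (Ne.symm hdist01), if_pos rfl, if_neg hdist12]; ring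
    by_cases h2 : n = 2 * d 3 + d 2
    · subst h2; rw [hcoef 2 (by decide), if_neg (Ne.symm hdist02), if_neg (Ne.symm hdist12), if_pos rfl]; ring
    have hn : n ∉ g.support := fun hn => by rcases hmemB n hn with h | h | h <;> contradiction
    rw [notMem_support_iff.mp hn, if_neg h0', if_neg h1, if_neg h2]; ring
  have h2 : 1 < ((C (W (2 * d 3 + d 0) * ((S 3).adjugate * S 0).trace) * X ^ (2 * d 3 + d 0)
      + C (W (2 * d 3 + d 1) * ((S 3).adjugate * S 1).trace) * X ^ (2 * d 3 + d 0 + a)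
      + C (W (2 * d 3 + d 2) * ((S 3).adjugate * S 2).trace) * X ^ (2 * d 3 + d 0 + a + b)).roots.toFinset.filter
        (fun x => 0 < x)).card := by
    rw [← hgeq]; omega
  exact trinomial_two_posRoots_le ha0 hb0 _ _ _ h2

end Summit.ValiantsHypothesis.ValiantsHypothesis.Theorems.LacunarySymmetroidMatrixDescartes.Census
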